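import Literature.NumberTheory.EllipticCurves.KubertTateNormalForm
import Literature.NumberTheory.EllipticCurves.TorsionPointNormalForms
import Literature.NumberTheory.EllipticCurves.XZeroFifteenExplicit
import Literature.NumberTheory.EllipticCurves.KubertTwoTwelveProofs
import Literature.NumberTheory.Automorphic.ThorneQInfinityModularRationalPointsProofs
import HarnessLib

/-!
# No elliptic curve over `ℚ` has a rational point of order `15` (Kubert 1976, Ch. IV: the case
# `m = 15` of Mazur's Thm. (7'))

Topic `NumberTheory/EllipticCurves`; a PROOFS file (theorems only, no `def`, no named fact) for the
`n = 15` leaf of Mazur's "First reduction" (hypothesis `h` of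
`Literature.NumberTheory.EllipticCurves.Mazur1977_reduction_to_primes_of_leaves`, file
`MazurTorsionReductionProofs`; Mazur 1977, Ch. III §5, p. 156, after Kubert 1976, Ch. IV:
`X₁(15)(ℚ)` is cuspidal). The case `n = 14` is `KubertFourteenProofs.lean`. Main result:
**`not_exists_addOrderOf_eq_fifteen`** — for every elliptic curve `V/ℚ` (any `DecidableEq ℚ`
instance for Mathlib's group law, as in `KubertFourteenProofs`), `¬ ∃ P ∈ V(ℚ), ord P = 15`.

## Proof (the modular curve `X₁(15)` through `X₀(15) ≅ 15a1`; every input is in the tree)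

1. If `ord P = 15`, `P₅ = 3P` has order `5` and `P₃ = 5P` order `3`. The Tate normal form at `P₅`
   (`exists_variableChange_pointEquiv_eq_zero`) gives `V(ℚ) ≃+ E(b, c)(ℚ)` with `P₅ ↦ (0, 0)`, and
   order `5` forces `b = c =: t`, `t ≠ 0`, `t² - 11t - 1 ≠ 0`, and the Hauptmodul
   `H = t - 11 - 1/t ≠ 0` of `X₀(5)` with `j H = (H² + 10H + 5)³` (`j_mul_tate_five`,
   `j_mul_hauptmodul_five`); the normal form at `P₃` gives `f` with `j f = (f + 27)(f + 3)³`.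
2. `X₀(15) ≅ E₁ = 15a1` (`XZeroFifteen.exists_point_hauptmodul`): `j ∈ {0, 1728}` — impossible
   for rational `H` — or a rational point `(x, y)` of `E₁` with `N B⁵ ≠ 0`, `H B = N`. By
   Thorne 2019 Prop. 4 (`Thorne2019.mem_E₁Points_of_equation`, proved from a `2`-descent) `(x, y)`
   is one of seven points: three cusps and `H ∈ {-10, -40, -25/8, -25/2}`. With
   `t² - (H + 11)t - 1 = 0`: `H = -10, -40` give `(2t - 1)² = 5`, `((2t + 29)/13)² = 5`;
   `H = -25/8, -25/2` give `t ∈ {8, -1/8}`, `{1/2, -2}` (Cremona's `50b` curves).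
3. For `t = 8, -2` the integral model `E(t, t) = [1 - t, -t, -t, 0, 0]` has `Δ = t⁵(t² - 11t - 1)`
   prime to `7` and `#Ẽ(𝔽₇) = 10` (`decide`), and prime-to-`7` torsion injects into `Ẽ(𝔽₇)`
   (Silverman *AEC* VII.3.1(b); `injective_reduceHom` of `PointReduction.lean`): no rational
   `3`-torsion; `t = -1/8, 1/2` go to `-1/t` by `E(t, t) ≅ E(-1/t, -1/t)`. But `P₃ ∈ V(ℚ)`.

## References

* [Kubert1976] D. S. Kubert, *Universal bounds on the torsion of elliptic curves*, Proc. London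
  Math. Soc. (3) 33 (1976) 193–237, Ch. IV (rational points of `X₁(N)`, `N` composite).
* [Mazur1977] B. Mazur, *Modular curves and the Eisenstein ideal*, Publ. Math. IHÉS 47 (1977):
  Thm. (7') p. 35; Ch. III §5, First reduction, p. 156.
* [Thorne2019] J. A. Thorne, *Elliptic curves over `ℚ_∞` are modular*, JEMS 21 (2019): Lemma 3
  (proof: `X₀(15) ≅ E₁`) and Prop. 4 (`E₁(ℚ) ≅ ℤ/2 ⊕ ℤ/4`).
* [Knapp1993] A. W. Knapp, *Elliptic Curves*, §V.5 (5.27)–(5.31) (Tate normal form).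
* [SilvermanAEC2009] J. H. Silverman, *The Arithmetic of Elliptic Curves*, 2nd ed.: III.1
  Table 3.1; Prop. VII.3.1(b).
-/

noncomputable section

open scoped NNReal
open WeierstrassCurve

namespace Literature.NumberTheory.EllipticCurves

/-! ### §1. The Hauptmodul of `X₀(3)` at a rational point of order `3` -/

section OrderThree

variable {F : Type*} [Field F] [DecidableEq F]

/-- **A rational point of order `3` gives a rational point of `X₀(3)` over `j`**: for `W/F` elliptic
and `P ∈ W(F)` of order `3` there is `f ∈ F` with `j(W) · f = (f + 27)(f + 3)³` (`f = a₁'³/a₃' - 27`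
for the normal form `y² + a₁'xy + a₃'y = x³` at `P`; the rational case of
`hauptmodul_three_of_order_three`). [cite: SilvermanAEC2009, III.1 Table 3.1] -/
theorem exists_hauptmodul_three_of_addOrderOf_eq_three {W : WeierstrassCurve F} [W.IsElliptic]
    {x₀ y₀ : F} {h : W.toAffine.Nonsingular x₀ y₀}
    (h3 : addOrderOf (Affine.Point.some x₀ y₀ h : W.toAffine.Point) = 3) :
    ∃ f : F, W.j * f = (f + 27) * (f + 3) ^ 3 := by
  -- `P + P = -P`
  have h30 : (3 : ℕ) • (Affine.Point.some x₀ y₀ h : W.toAffine.Point) = 0 :=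
    h3 ▸ addOrderOf_nsmul_eq_zero _
  rw [show (3 : ℕ) = 2 + 1 from rfl, succ_nsmul, two_nsmul] at h30
  have h3' : (Affine.Point.some x₀ y₀ h : W.toAffine.Point) + .some x₀ y₀ h = -.some x₀ y₀ h :=
    eq_neg_of_add_eq_zero_left h30
  -- `P ≠ -P`
  have hy : y₀ ≠ W.toAffine.negY x₀ y₀ := by
    intro hyy
    have hneg : -(Affine.Point.some x₀ y₀ h : W.toAffine.Point) = .some x₀ y₀ h := by
      rw [Affine.Point.neg_some]
      exact (Affine.Point.some.injEq _ _ _ _ _ _).mpr ⟨rfl, hyy.symm⟩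
    rw [hneg, add_eq_left] at h3'
    exact Affine.Point.some_ne_zero _ h3'
  -- the normal form at `P`
  have hV' := variableChange_tangent_eq (W := W) h.1 hy
  obtain ⟨h₀, hP'⟩ := pointEquiv_tangent_some (W := W) h
  revert hV'; revert hP'; revert h₀
  generalize (⟨1, x₀, W.toAffine.slope x₀ x₀ y₀ y₀, y₀⟩ : VariableChange F) = C
  intro h₀ hP' hV'
  have h4' : (C • W).a₄ = 0 := by rw [hV']
  have h6' : (C • W).a₆ = 0 := by rw [hV']
  have h3'' : (C • W).a₃ ≠ 0 := by rw [hV']; exact sub_ne_zero.2 hy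
  have key := congrArg (VariableChange.pointEquiv W C) h3'
  rw [map_add, map_neg, hP'] at key
  have hA2 : (C • W).a₂ = 0 := a₂_eq_zero_of_two_smul_eq_neg h4' h6' h3'' key
  obtain ⟨-, -, hjf⟩ := j_mul_hauptmodul_three (W := C • W) hA2 h4' h6'
  rw [variableChange_j] at hjf
  exact ⟨_, hjf⟩

end OrderThree

/-! ### §2. The Tate normal form at a rational point of order `5` -/

section OrderFive

variable {F : Type*} [Field F] [DecidableEq F]

/-- **A rational point of order `5` puts the curve in Tate normal form `E(t, t)`**: for `V/F`
elliptic and `P ∈ V(F)` of order `5` there are `t ∈ F` and `V(F) ≃+ E(t, t)(F)`,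
`E(t, t) = kubertTate t t` (Knapp §V.5: `V ≅ E(b, c)` with `P ↦ (0, 0)`, and
`3·(0,0) = (c, b - c) = -(2·(0,0)) = (b, 0)` forces `b = c`), with `t ≠ 0`, `t² - 11t - 1 ≠ 0`,
`j(V) · t⁵(t² - 11t - 1) = (t⁴ - 12t³ + 14t² + 12t + 1)³`. [cite: Knapp1993, §V.5 (5.27)–(5.31)] -/
theorem exists_kubertTate_of_addOrderOf_eq_five {V : WeierstrassCurve F} [V.IsElliptic]
    {x y : F} {hxy : V.toAffine.Nonsingular x y}
    (h5 : addOrderOf (Affine.Point.some x y hxy : V.toAffine.Point) = 5) :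
    ∃ (t : F) (_ : V.toAffine.Point ≃+ (kubertTate t t).toAffine.Point),
      t ≠ 0 ∧ t ^ 2 - 11 * t - 1 ≠ 0 ∧ V.j * (t ^ 5 * (t ^ 2 - 11 * t - 1)) =
        (t ^ 4 - 12 * t ^ 3 + 14 * t ^ 2 + 12 * t + 1) ^ 3 := by
  have h₂ : 2 • (Affine.Point.some x y hxy : V.toAffine.Point) ≠ 0 := fun h0 ↦ by
    have hdvd := addOrderOf_dvd_of_nsmul_eq_zero h0; rw [h5] at hdvd; omega
  have h₃ : 3 • (Affine.Point.some x y hxy : V.toAffine.Point) ≠ 0 := fun h0 ↦ by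
    have hdvd := addOrderOf_dvd_of_nsmul_eq_zero h0; rw [h5] at hdvd; omega
  obtain ⟨b, c, C, hC, h₀, he⟩ := exists_variableChange_pointEquiv_eq_zero V hxy h₂ h₃
  have hb0 : b ≠ 0 := (kubertTate_nonsingular_zero_iff b c).mp h₀
  -- the order of `(0, 0)` is `5`, so `3·(0,0) = -(2·(0,0))` and `b = c`
  have hP0 : addOrderOf (Affine.Point.some 0 0 h₀ : (kubertTate b c).toAffine.Point) = 5 := by
    rw [← he, AddEquiv.addOrderOf_eq, AddEquiv.addOrderOf_eq, h5]
  have h50 : (5 : ℕ) • (Affine.Point.some 0 0 h₀ : (kubertTate b c).toAffine.Point) = 0 :=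
    hP0 ▸ addOrderOf_nsmul_eq_zero _
  rw [show (5 : ℕ) = 3 + 2 from rfl, add_nsmul, kubertTate_three_nsmul_zero b c h₀,
    kubertTate_two_nsmul_zero b c h₀] at h50
  have h32 := eq_neg_of_add_eq_zero_left h50
  rw [Affine.Point.neg_some] at h32
  have hcb : c = b := ((Affine.Point.some.injEq _ _ _ _ _ _).mp h32).1
  -- the Tate parameter `t = -a₂'³/a₃'² = b` of `C • V = E(b, b)` and the `j`-invariant
  have h4 : (C • V).a₄ = 0 := by rw [hC, kubertTate_a₄]
  have h6 : (C • V).a₆ = 0 := by rw [hC, kubertTate_a₆]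
  have hA1 : (C • V).a₁ = 1 - b := by rw [hC, kubertTate_a₁, hcb]
  have hA2 : (C • V).a₂ = -b := by rw [hC, kubertTate_a₂]
  have hA3 : (C • V).a₃ = -b := by rw [hC, kubertTate_a₃]
  obtain ⟨ht0, h11, hjt⟩ := j_mul_tate_five (W := C • V) h4 h6
    (by rw [hA2]; exact neg_ne_zero.mpr hb0) (by rw [hA3]; exact neg_ne_zero.mpr hb0)
    (by rw [hA1, hA2, hA3]; ring)
  rw [variableChange_j] at hjt
  have hT : -(C • V).a₂ ^ 3 / (C • V).a₃ ^ 2 = b := by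
    rw [hA2, hA3]
    field_simp
  rw [hT] at ht0 h11 hjt
  exact ⟨b, ((VariableChange.pointEquiv V C).trans (Affine.Point.congrEquiv hC)).trans
    (Affine.Point.congrEquiv (by rw [hcb])), ht0, h11, hjt⟩

omit [DecidableEq F] in
/-- **`E(t, t) ≅ E(-1/t, -1/t)` (the pairs `(E, P₅)` and `(E, 2P₅)`)**: for `t t' = -1` the change
of variables `(u, r, s, t₀) = (t, t, t, t²)`, moving `2·(0,0) = (t, t²)` to the origin, carries
`E(t, t)` to `E(t', t')` (cf. `WeierstrassCurve.tate_t_double`). [folklore] -/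
private theorem variableChange_kubertTate_of_mul_eq_neg_one {t t' : F} (ht : t ≠ 0)
    (htt : t * t' = -1) :
    (⟨Units.mk0 t ht, t, t, t ^ 2⟩ : VariableChange F) • kubertTate t t = kubertTate t' t' := by
  have ht' : t' = -t⁻¹ := by
    field_simp
    linear_combination htt
  subst ht'
  ext <;> simp only [kubertTate, variableChange_a₁, variableChange_a₂, variableChange_a₃,
    variableChange_a₄, variableChange_a₆, Units.val_inv_eq_inv_val, Units.val_mk0] <;>
    field_simp <;> ring

/-- **The group isomorphism `E(t, t)(F) ≃+ E(t', t')(F)` for `t t' = -1`** (the change of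
variables of `variableChange_kubertTate_of_mul_eq_neg_one` acting on points). [folklore] -/
private theorem nonempty_addEquiv_kubertTate_of_mul_eq_neg_one {t t' : F} (ht : t ≠ 0)
    (htt : t * t' = -1) :
    Nonempty ((kubertTate t t).toAffine.Point ≃+ (kubertTate t' t').toAffine.Point) :=
  ⟨(VariableChange.pointEquiv (kubertTate t t) ⟨Units.mk0 t ht, t, t, t ^ 2⟩).trans
    (Affine.Point.congrEquiv (variableChange_kubertTate_of_mul_eq_neg_one ht htt))⟩

end OrderFive

/-! ### §3. Reduction modulo `7` of the Tate normal forms with `t = 8`, `-2` -/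

/-- **Point count of `E(n, n)` over `𝔽₇` from an enumeration of the affine solutions** (the curve
being nonsingular, its points are `O` and the solutions of the Weierstrass equation). [folklore] -/
private theorem natCard_point_kubertTate_zmod_seven (n : ℤ) (k : ℕ)
    (hΔ : (kubertTate (n : ZMod 7) (n : ZMod 7)).Δ ≠ 0)
    (hsol : Fintype.card {xy : ZMod 7 × ZMod 7 //
      xy.2 ^ 2 + (1 - (n : ZMod 7)) * xy.1 * xy.2 + -(n : ZMod 7) * xy.2 =
        xy.1 ^ 3 + -(n : ZMod 7) * xy.1 ^ 2 + 0 * xy.1 + 0} = k) :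
    Nat.card (kubertTate (n : ZMod 7) (n : ZMod 7)).toAffine.Point = k + 1 := by
  haveI : Fact (Nat.Prime 7) := ⟨by norm_num⟩
  haveI : (kubertTate (n : ZMod 7) (n : ZMod 7)).IsElliptic := ⟨isUnit_iff_ne_zero.mpr hΔ⟩
  have e : {xy : ZMod 7 × ZMod 7 //
      (kubertTate (n : ZMod 7) (n : ZMod 7)).toAffine.Equation xy.1 xy.2} ≃
      {xy : ZMod 7 × ZMod 7 //
        xy.2 ^ 2 + (1 - (n : ZMod 7)) * xy.1 * xy.2 + -(n : ZMod 7) * xy.2 =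
          xy.1 ^ 3 + -(n : ZMod 7) * xy.1 ^ 2 + 0 * xy.1 + 0} :=
    Equiv.subtypeEquivRight fun xy => by rw [Affine.equation_iff]; rfl
  rw [Nat.card_congr (WeierstrassCurve.Affine.pointEquiv
    (kubertTate (n : ZMod 7) (n : ZMod 7)).toAffine)]
  change Nat.card (Option _) = k + 1
  rw [Finite.card_option, Nat.card_congr e, Nat.card_eq_fintype_card, hsol]

/-- **No rational `3`-torsion on an integral `E(n, n)` with good reduction at `7` and
`#Ẽ(𝔽₇) = 10`**: for `n ∈ ℤ` with `7 ∤ n⁵(n² - 11n - 1) = Δ`, every rational `Q` with `3Q = 0` is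
`0` — the prime-to-`7` torsion injects into `Ẽ(𝔽₇)` (`injective_reduceHom` for the `7`-adic
absolute value and the residue map `ℤ_(7) → ℤ₇ → 𝔽₇`, as in
`KubertTwoTwelveProofs.exists_reduceHom`), where the image is killed by `3` and `10`; classical
`DecidableEq ℚ`, as in `PointReduction.lean`. [cite: SilvermanAEC2009, Prop. VII.3.1(b)] -/
theorem kubertTate_eq_zero_of_three_nsmul_eq_zero (n : ℤ) (t : ℚ) (hn : (n : ℚ) = t)
    (h7 : IsCoprime (n ^ 5 * (n ^ 2 - 11 * n - 1)) 7)
    (hcard : Nat.card (kubertTate (n : ZMod 7) (n : ZMod 7)).toAffine.Point = 10) :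
    letI := Classical.decEq ℚ
    ∀ Q : (kubertTate t t).toAffine.Point, (3 : ℕ) • Q = 0 → Q = 0 := by
  subst hn
  letI := Classical.decEq ℚ
  letI := Classical.decEq (ZMod 7)
  haveI : Fact (Nat.Prime 7) := ⟨by norm_num⟩
  intro Q hQ
  set w : Valuation ℚ ℝ≥0 := NormedField.valuation.comap (Rat.castHom ℚ_[7]) with hw
  have hw1 : ∀ q : ℚ, w q ≤ 1 ↔ ‖(q : ℚ_[7])‖ ≤ 1 := fun q => by
    rw [hw, Valuation.comap_apply, ← NNReal.coe_le_coe, NNReal.coe_one]; rfl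
  have hw1' : ∀ q : ℚ, w q < 1 ↔ ‖(q : ℚ_[7])‖ < 1 := fun q => by
    rw [hw, Valuation.comap_apply, ← NNReal.coe_lt_coe, NNReal.coe_one]; rfl
  have hnmem : (n : ℚ) ∈ w.integer := Curve24A1.intCast_mem_integer 7 n
  have hn1 : w (n : ℚ) ≤ 1 := hnmem
  -- the integral model `[1 - n, -n, -n, 0, 0]` over `ℤ_(7)`
  haveI : (kubertTate (n : ℚ) (n : ℚ)).IsIntegral w.integer :=
    ⟨⟨⟨1 - n, sub_mem (one_mem _) hnmem⟩, ⟨-n, neg_mem hnmem⟩, ⟨-n, neg_mem hnmem⟩,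
      ⟨0, zero_mem _⟩, ⟨0, zero_mem _⟩⟩, rfl⟩
  -- the residue map `ℤ_(7) → ℤ₇ → 𝔽₇`
  let ι : w.integer →+* ℤ_[7] :=
    { toFun := fun a => ⟨((a : ℚ) : ℚ_[7]), (hw1 a).mp a.2⟩
      map_one' := Subtype.ext (by simp)
      map_mul' := fun a b => Subtype.ext (by simp)
      map_zero' := Subtype.ext (by simp)
      map_add' := fun a b => Subtype.ext (by simp) }
  let r : w.integer →+* ZMod 7 := PadicInt.toZMod.comp ι
  have hr : ∀ a : w.integer, r a = 0 ↔ w (a : ℚ) < 1 := fun a => by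
    rw [hw1', RingHom.comp_apply, ← RingHom.mem_ker, PadicInt.ker_toZMod,
      IsLocalRing.mem_maximalIdeal, PadicInt.mem_nonunits, PadicInt.norm_def]
    rfl
  -- good reduction: `Δ = n⁵(n² - 11n - 1)` is a `7`-adic unit
  have hΔ : w (kubertTate (n : ℚ) (n : ℚ)).Δ = 1 := by
    have hΔ' : (kubertTate (n : ℚ) (n : ℚ)).Δ = ((n ^ 5 * (n ^ 2 - 11 * n - 1) : ℤ) : ℚ) := by
      rw [kubertTate_Δ]; push_cast; ring
    rw [hΔ', Valuation.comap_apply, ← NNReal.coe_eq_one]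
    change ‖(((n ^ 5 * (n ^ 2 - 11 * n - 1) : ℤ) : ℚ) : ℚ_[7])‖ = 1
    rw [Rat.cast_intCast]
    exact Padic.norm_intCast_eq_one_iff.mpr h7
  -- the reduced equation is `E(n mod 7, n mod 7)`
  have hred : reduceCurve r (kubertTate (n : ℚ) (n : ℚ)) =
      kubertTate (n : ZMod 7) (n : ZMod 7) := by
    ext
    · show reduceFun r (1 - (n : ℚ)) = 1 - (n : ZMod 7)
      rw [reduceFun_sub r (map_one w).le hn1, reduceFun_one, reduceFun_intCast]
    · show reduceFun r (-(n : ℚ)) = -(n : ZMod 7)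
      rw [reduceFun_neg r hn1, reduceFun_intCast]
    · show reduceFun r (-(n : ℚ)) = -(n : ZMod 7)
      rw [reduceFun_neg r hn1, reduceFun_intCast]
    · exact reduceFun_zero r
    · exact reduceFun_zero r
  have hf := injective_reduceHom hr hΔ hred
  -- `Q` lies in the prime-to-`7` torsion; its image is killed by `3` and by `#Ẽ(𝔽₇) = 10`
  have hQ' : Q ∈ goodTorsion w (kubertTate (n : ℚ) (n : ℚ)) :=
    mem_goodTorsion_of_zsmul_eq_zero (n := ((3 : ℕ) : ℤ))
      (by rw [Int.cast_natCast]; exact Curve24A1.valuation_natCast_eq_one 7 (by norm_num))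
      (by rw [natCast_zsmul, hQ])
  have h3 : (3 : ℕ) • reduceHom w r hr hΔ hred ⟨Q, hQ'⟩ = 0 := by
    rw [← map_nsmul]
    have : (3 : ℕ) • (⟨Q, hQ'⟩ : goodTorsion w (kubertTate (n : ℚ) (n : ℚ))) = 0 :=
      Subtype.ext (by simpa using hQ)
    rw [this, map_zero]
  have hord : addOrderOf (reduceHom w r hr hΔ hred ⟨Q, hQ'⟩) ∣ Nat.gcd 3 10 :=
    Nat.dvd_gcd (addOrderOf_dvd_of_nsmul_eq_zero h3) (hcard ▸ addOrderOf_dvd_natCard _)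
  have h0 : reduceHom w r hr hΔ hred ⟨Q, hQ'⟩ = 0 :=
    AddMonoid.addOrderOf_eq_one_iff.mp (Nat.dvd_one.mp ((show Nat.gcd 3 10 = 1 by decide) ▸ hord))
  exact congrArg Subtype.val (hf (h0.trans (map_zero _).symm))

/-- **The four Tate parameters over `X₀(15)`: no rational `3`-torsion on `E(t, t)` for
`t ∈ {8, -1/8, 1/2, -2}`** — `t = 8, -2` by reduction modulo `7`
(`kubertTate_eq_zero_of_three_nsmul_eq_zero`), `t = -1/8, 1/2` carried there by
`E(t, t) ≅ E(-1/t, -1/t)` (`nonempty_addEquiv_kubertTate_of_mul_eq_neg_one`). [folklore] -/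
private theorem kubertTate_eq_zero_of_three_nsmul_eq_zero_of_mem {t : ℚ}
    (ht : t = 8 ∨ t = -1 / 8 ∨ t = 1 / 2 ∨ t = -2) :
    letI := Classical.decEq ℚ
    ∀ Q : (kubertTate t t).toAffine.Point, (3 : ℕ) • Q = 0 → Q = 0 := by
  letI := Classical.decEq ℚ
  -- `#E(8, 8)(𝔽₇) = #E(-2, -2)(𝔽₇) = 10`: nine affine solutions each, by `decide`
  have h8 := kubertTate_eq_zero_of_three_nsmul_eq_zero 8 8 (by norm_num)
    (by norm_num [Int.isCoprime_iff_gcd_eq_one])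
    (natCard_point_kubertTate_zmod_seven 8 9 (by rw [kubertTate_Δ]; decide) (by decide))
  have h2 := kubertTate_eq_zero_of_three_nsmul_eq_zero (-2) (-2) (by norm_num)
    (by norm_num [Int.isCoprime_iff_gcd_eq_one])
    (natCard_point_kubertTate_zmod_seven (-2) 9 (by rw [kubertTate_Δ]; decide) (by decide))
  rcases ht with rfl | rfl | rfl | rfl
  · exact h8
  · intro Q hQ
    obtain ⟨e⟩ := nonempty_addEquiv_kubertTate_of_mul_eq_neg_one (F := ℚ) (t := -1 / 8)
      (t' := 8) (by norm_num) (by norm_num)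
    exact (map_eq_zero_iff e e.injective).mp (h8 _ (by rw [← map_nsmul, hQ, map_zero]))
  · intro Q hQ
    obtain ⟨e⟩ := nonempty_addEquiv_kubertTate_of_mul_eq_neg_one (F := ℚ) (t := 1 / 2)
      (t' := -2) (by norm_num) (by norm_num)
    exact (map_eq_zero_iff e e.injective).mp (h2 _ (by rw [← map_nsmul, hQ, map_zero]))
  · exact h2

/-! ### §4. No rational point of order `15` -/

/-- **No rational point of order `15` (Kubert 1976, Ch. IV; the case `m = 15` of Mazur's
Thm. (7')).** For every elliptic curve `V` over `ℚ`, no point of `V(ℚ)` has order `15` — the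
`n = 15` conjunct of the hypothesis of `Mazur1977_reduction_to_primes_of_leaves` (Mazur 1977,
Ch. III §5, p. 156, after Kubert: `X₁(15)(ℚ)` is cuspidal); proof in the module docstring. Stated
for an arbitrary `DecidableEq ℚ` instance, as the group law of `V.toAffine.Point` is.
[cite: Kubert1976, Ch. IV (X₁(15)); Mazur1977, Thm. (7') p. 35 and Ch. III §5 p. 156] -/
theorem not_exists_addOrderOf_eq_fifteen [inst : DecidableEq ℚ] (V : WeierstrassCurve ℚ)
    [V.IsElliptic] : ¬ ∃ P : V.toAffine.Point, addOrderOf P = 15 := by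
  obtain rfl : inst = Classical.decEq ℚ := Subsingleton.elim _ _
  letI : DecidableEq ℚ := Classical.decEq ℚ
  rintro ⟨P, hP⟩
  -- `P₅ = 3P` has order `5`, `P₃ = 5P` has order `3`
  have h5 : addOrderOf ((3 : ℕ) • P) = 5 := by
    rw [addOrderOf_nsmul' P (by norm_num : (3 : ℕ) ≠ 0), hP]; decide
  have h3 : addOrderOf ((5 : ℕ) • P) = 3 := by
    rw [addOrderOf_nsmul' P (by norm_num : (5 : ℕ) ≠ 0), hP]; decide
  rcases hP5 : (3 : ℕ) • P with _ | ⟨x, y, hxy⟩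
  · rw [hP5, ← Affine.Point.zero_def, addOrderOf_zero] at h5; omega
  rcases hP3 : (5 : ℕ) • P with _ | ⟨x₃, y₃, h₃⟩
  · rw [hP3, ← Affine.Point.zero_def, addOrderOf_zero] at h3; omega
  rw [hP5] at h5; rw [hP3] at h3
  -- Tate normal form at `P₅`; the Hauptmoduln of `X₀(5)` and `X₀(3)`
  obtain ⟨t, e, ht0, ht11, hjt⟩ := exists_kubertTate_of_addOrderOf_eq_five h5
  obtain ⟨hH0, hjH⟩ := j_mul_hauptmodul_five ht0 ht11 hjt
  obtain ⟨f, hjF⟩ := exists_hauptmodul_three_of_addOrderOf_eq_three h3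
  -- the point of order `3` on `E(t, t)(ℚ)`: it suffices that `t ∉ {8, -1/8, 1/2, -2}`
  have hQ3 : addOrderOf (e (Affine.Point.some x₃ y₃ h₃)) = 3 := by rw [AddEquiv.addOrderOf_eq, h3]
  have hnot : ¬ (t = 8 ∨ t = -1 / 8 ∨ t = 1 / 2 ∨ t = -2) := fun ht ↦ by
    have h0 := kubertTate_eq_zero_of_three_nsmul_eq_zero_of_mem ht _
      (hQ3 ▸ addOrderOf_nsmul_eq_zero (e (Affine.Point.some x₃ y₃ h₃)))
    rw [h0, addOrderOf_zero] at hQ3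
    omega
  -- `X₀(15) ≅ E₁`
  obtain hj0 | hj1728 | ⟨x₁, y₁, hE, hHB, hNB, -⟩ :=
    XZeroFifteen.exists_point_hauptmodul hH0 hjF hjH
  · -- `j = 0`: `H² + 10H + 5 = 0`, i.e. `((H + 5)/2)² = 5`
    rw [hj0, zero_mul] at hjH
    have hq := pow_eq_zero_iff three_ne_zero |>.mp hjH.symm
    exact Curve15A1.five_ne_sq (((t ^ 2 - 11 * t - 1) / t + 5) / 2)
      (by linear_combination (-1 / 4 : ℚ) * hq)
  · -- `j = 1728`: `(H² + 22H + 125)(H² + 4H - 1)² = 0`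
    rw [hj1728] at hjH
    have key : (((t ^ 2 - 11 * t - 1) / t) ^ 2 + 22 * ((t ^ 2 - 11 * t - 1) / t) + 125) *
        (((t ^ 2 - 11 * t - 1) / t) ^ 2 + 4 * ((t ^ 2 - 11 * t - 1) / t) - 1) ^ 2 = 0 := by
      linear_combination (-1 : ℚ) * hjH
    rcases mul_eq_zero.mp key with h1 | h2
    · nlinarith [sq_nonneg ((t ^ 2 - 11 * t - 1) / t + 11)]
    · exact Curve15A1.five_ne_sq ((t ^ 2 - 11 * t - 1) / t + 2)
        (by linear_combination -(pow_eq_zero_iff two_ne_zero |>.mp h2))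
  -- the rational points of `E₁ = 15a1` (Thorne 2019, Prop. 4)
  have hmem := Literature.NumberTheory.Automorphic.Thorne2019.mem_E₁Points_of_equation
    (Curve15A1.equation_of_eq hE)
  simp only [Literature.NumberTheory.Automorphic.Thorne2019.E₁Points, Set.mem_insert_iff,
    Set.mem_singleton_iff, Prod.mk.injEq] at hmem
  -- `t² - 11t - 1 = H t`
  have hrel : t ^ 2 - 11 * t - 1 = (t ^ 2 - 11 * t - 1) / t * t := by field_simp
  rcases hmem with ⟨rfl, rfl⟩ | ⟨rfl, rfl⟩ | ⟨rfl, rfl⟩ | ⟨rfl, rfl⟩ | ⟨rfl, rfl⟩ | ⟨rfl, rfl⟩ |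
      ⟨rfl, rfl⟩
  · -- `(-13/4, 9/8)`: `H = -10`, `t² - t - 1 = 0`, `(2t - 1)² = 5`
    norm_num at hHB
    have hH : (t ^ 2 - 11 * t - 1) / t = -10 := by linarith
    rw [hH] at hrel
    exact Curve15A1.five_ne_sq (2 * t - 1) (by linear_combination (-4 : ℚ) * hrel)
  · -- `(-2, -2)`: a cusp
    norm_num at hHB
  · -- `(-2, 3)`: `H = -25/8`, `(t - 8)(8t + 1) = 0`
    norm_num at hHB
    have hH : (t ^ 2 - 11 * t - 1) / t = -25 / 8 := by linarith
    rw [hH] at hrel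
    have hsplit : (t - 8) * (8 * t + 1) = 0 := by linear_combination (8 : ℚ) * hrel
    exact (mul_eq_zero.mp hsplit).elim (fun h8 ↦ hnot (Or.inl (by linarith))) fun h8 ↦
      hnot (Or.inr (Or.inl (by linarith)))
  · -- `(-1, 0)`: a cusp
    norm_num at hNB
  · -- `(3, -2)`: `H = -40`, `t² + 29t - 1 = 0`, `((2t + 29)/13)² = 5`
    norm_num at hHB
    have hH : (t ^ 2 - 11 * t - 1) / t = -40 := by linarith
    rw [hH] at hrel
    exact Curve15A1.five_ne_sq ((2 * t + 29) / 13)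
      (by linear_combination (-4 / 169 : ℚ) * hrel)
  · -- `(8, -27)`: a cusp
    norm_num at hHB
  · -- `(8, 18)`: `H = -25/2`, `(t + 2)(2t - 1) = 0`
    norm_num at hHB
    have hH : (t ^ 2 - 11 * t - 1) / t = -25 / 2 := by linarith
    rw [hH] at hrel
    have hsplit : (t + 2) * (2 * t - 1) = 0 := by linear_combination (2 : ℚ) * hrel
    exact (mul_eq_zero.mp hsplit).elim (fun h8 ↦ hnot (Or.inr (Or.inr (Or.inr (by linarith)))))
      fun h8 ↦ hnot (Or.inr (Or.inr (Or.inl (by linarith))))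

end Literature.NumberTheory.EllipticCurves

end
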